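import Summits.AtomisticToContinuum.HydrodynamicLimit.Theses.OneFlightGossipEngine
import Literature.MathematicalPhysics.KineticTheory.HardSphereEulerProofs
import HarnessLib

/-!
# `CollisionActivityTails` (stmt-AtomisticToContinuum-13734): the crux is EXACTLY a level-form one-sided law of
large numbers for the tagged window activity

Helper file (`--supports stmt-AtomisticToContinuum-13734`) for the crux
`Summit.AtomisticToContinuum.HydrodynamicLimit.Theses.OneFlightGossipEngine.CollisionActivityTails`
(route OneFlightGossipEngine, item #6; route TwoClocks carried the byte-identical copy
`…Theses.TwoClocks.CollisionActivityTails` until its rev 10, see the maintenance record), skeleton line `SketchK1`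
(`Cruxes/CollisionActivityTails/Lines/SketchK1.lean`), registered stub `stub_collisionActivityTailsIffExcessDecay`
(now the deprecated alias of `collisionActivityTails_iff_excessDecay'`).

Two results.

* `tailShape_iff_excessShape` — GENERIC in the functional and the laws: for any family of per-particle
  functionals `f N τ s i z` and laws `μ N`, the crux-shaped tail statement
  `∃ V₀ > 0 ∀ V ≥ V₀ ∀ ε > 0 ∃ τ₀ ∀ τ ≥ τ₀ ∃ N₀ ∀ N ≥ N₀ ∀ s ∈ [0,t]: ∫ (N+1)⁻¹ Σ_i 𝟙{V < f_i} f_i dμ_N ≤ ε`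
  is equivalent to the LEVEL-FORM ONE-SIDED LLN
  `∃ m ≥ 0 ∀ δ > 0 ∃ τ₀ ∀ τ ≥ τ₀ ∃ N₀ ∀ N ≥ N₀ ∀ s ∈ [0,t]: ∫ (N+1)⁻¹ Σ_i (f_i − m)₊ dμ_N ≤ δ`
  (pure scalar algebra — `(y − V)₊ ≤ 𝟙{V < y} y` for `V ≥ 0` and `𝟙{V < y} y ≤ V/(V−m)·(y − m)₊` for
  `0 ≤ m < V`, proved inline — plus monotonicity and homogeneity of `∫⁻`; no measurability, no dynamics). It applies verbatim to
  the three functionals of line `SketchK1` (activity, near-field kinetic term, crowded activity).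
* `collisionActivityTails_iff_excessDecay' : CollisionActivityTails ↔ CollisionActivityExcessDecay` (deprecated
  alias `stub_collisionActivityTailsIffExcessDecay`) — the crux BY NAME is the statement that, for small `σ` and pre-shock times, the window activity `a_i` of a tagged sphere
  under the TRUE law has an `L¹`-limsup essentially bounded by a deterministic level `m`:
  `E_{λ_N}[(N+1)⁻¹ Σ_i (a_i − m)₊] → 0` as `τ → ∞` after `N → ∞`, uniformly in `s ≤ t < T`. This is the sharp
  form of the standing Disproof's shape analysis (§3: the crux is asymptotic essential boundedness, strictly
  stronger than uniform integrability, and no family of moment bounds implies it): what a proof must produce is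
  exactly a one-sided concentration of the time-averaged activity at SOME level, nothing more and nothing less.

References: Chebyshev-type level comparisons are folklore (the same scalar lemmas, for the near-field term, are in the
sibling helper `…NearFieldKineticExcess.lean`, p97901 — not imported here while its farm olean is unbuilt); H. Spohn, *Large Scale Dynamics of Interacting
Particles* (1991), Part I §2.3 (local Gibbs laws); the shape analysis is `Cruxes/CollisionActivityTails/Disproof.lean` §3.

Maintenance record (full-build repair, 2026-08-17; dependency drift, content unchanged). Route TwoClocks rev 10
(2026-08-16T20:17Z) RESTATED its copy of the crux as `TransferActivityTails` (stmt-AtomisticToContinuum-16624,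
momentum + energy impulse — a different statement), so `…Theses.TwoClocks.CollisionActivityTails` no longer exists
and `stub_collisionActivityTailsIffExcessDecay`, which spelled that identifier in its signature, stopped elaborating
(159:4). The statement of stmt-13734 is unchanged and still declared, verbatim, as
`…Theses.OneFlightGossipEngine.CollisionActivityTails`; the landed twin `collisionActivityTails_iff_excessDecay'`
(statement byte-identical) now carries the proof directly, the old stub name is kept as its `@[deprecated]` alias
(append-only; same pattern as `CollisionActivityTails/Negative/Kinematics.lean`), and the import of
`Theses.TwoClocks`, which contributed nothing else, is dropped.
-/

noncomputable section

open MeasureTheory Set Filter Topology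
open scoped ENNReal

namespace Summit.AtomisticToContinuum.HydrodynamicLimit.Theorems.CollisionActivityTailsExcessShape

open Literature.MathematicalPhysics.KineticTheory Literature.Analysis.FluidPDE

/-! ## The scalar tail functional -/

/-- The scalar tail functional `y ↦ 𝟙{V < y} y` (the crux's integrand is `(N+1)⁻¹ Σ_i tailFn V (a_i)`). -/
def tailFn (V y : ℝ) : ℝ := Set.indicator {y : ℝ | V < y} (fun y => y) y

/-! ## The generic equivalence of the two quantifier shapes -/

/-- **Crux shape ⇔ level-form one-sided LLN**, generic in the per-particle functional `f N τ s i z` and in the laws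
`μ N` (any index types). `→`: take `m := V₀` and use `(y − V₀)₊ ≤ 𝟙{V₀ < y} y`. `←`: take `V₀ := m + 1`; for
`V ≥ V₀`, `𝟙{V < y} y ≤ V/(V−m)·(y − m)₊` and ask the excess for accuracy `ε (V − m)/V`. -/
theorem tailShape_iff_excessShape {Ω : ℕ → Type*} [∀ N, MeasurableSpace (Ω N)] (μ : (N : ℕ) → Measure (Ω N))
    (f : (N : ℕ) → ℝ → ℝ → Fin (N + 1) → Ω N → ℝ) (S : Set ℝ) :
    (∃ V₀ : ℝ, 0 < V₀ ∧ ∀ V : ℝ, V₀ ≤ V → ∀ ε : ℝ, 0 < ε →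
      ∃ τ₀ : ℝ, 0 < τ₀ ∧ ∀ τ : ℝ, τ₀ ≤ τ → ∃ N₀ : ℕ, ∀ N : ℕ, N₀ ≤ N → ∀ s ∈ S,
        ∫⁻ z, ENNReal.ofReal (((N : ℝ) + 1)⁻¹ * ∑ i : Fin (N + 1), tailFn V (f N τ s i z)) ∂(μ N) ≤
          ENNReal.ofReal ε) ↔
    (∃ m : ℝ, 0 ≤ m ∧ ∀ δ : ℝ, 0 < δ →
      ∃ τ₀ : ℝ, 0 < τ₀ ∧ ∀ τ : ℝ, τ₀ ≤ τ → ∃ N₀ : ℕ, ∀ N : ℕ, N₀ ≤ N → ∀ s ∈ S,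
        ∫⁻ z, ENNReal.ofReal (((N : ℝ) + 1)⁻¹ * ∑ i : Fin (N + 1), max (f N τ s i z - m) 0) ∂(μ N) ≤
          ENNReal.ofReal δ) := by
  -- the two level comparisons of the scalar tail functional (cf. the sibling helper …NearFieldKineticExcess.lean)
  have tailFn_eq : ∀ V y : ℝ, tailFn V y = if V < y then y else 0 := fun V y => by
    unfold tailFn Set.indicator
    rfl
  have posPart_le_tailFn : ∀ {V : ℝ}, 0 ≤ V → ∀ y : ℝ, max (y - V) 0 ≤ tailFn V y := fun {V} hV y => by
    rw [tailFn_eq]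
    split_ifs with h
    · exact max_le (by linarith) (hV.trans h.le)
    · exact max_le (by linarith [not_lt.1 h]) le_rfl
  have tailFn_le_mul_posPart : ∀ {m V : ℝ}, 0 ≤ m → m < V → ∀ y : ℝ,
      tailFn V y ≤ V / (V - m) * max (y - m) 0 := fun {m V} hm hV y => by
    have hVm : 0 < V - m := sub_pos.2 hV
    rw [tailFn_eq]
    split_ifs with h
    · rw [max_eq_left (by linarith), div_mul_eq_mul_div, le_div_iff₀ hVm]
      nlinarith
    · exact mul_nonneg (div_nonneg (hm.trans hV.le) hVm.le) (le_max_right _ _)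
  constructor
  · rintro ⟨V₀, hV₀, hV⟩
    refine ⟨V₀, hV₀.le, fun δ hδ => ?_⟩
    obtain ⟨τ₀, hτ₀, hτ⟩ := hV V₀ le_rfl δ hδ
    refine ⟨τ₀, hτ₀, fun τ hττ => ?_⟩
    obtain ⟨N₀, hN⟩ := hτ τ hττ
    refine ⟨N₀, fun N hNN s hs => le_trans (lintegral_mono fun z => ENNReal.ofReal_le_ofReal ?_) (hN N hNN s hs)⟩
    exact mul_le_mul_of_nonneg_left (Finset.sum_le_sum fun i _ => posPart_le_tailFn hV₀.le _)
      (inv_nonneg.2 (by positivity))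
  · rintro ⟨m, hm, hδ⟩
    refine ⟨m + 1, by linarith, fun V hVV ε hε => ?_⟩
    have hmV : m < V := by linarith
    have hc : 0 < V / (V - m) := div_pos (by linarith) (sub_pos.2 hmV)
    obtain ⟨τ₀, hτ₀, hτ⟩ := hδ (ε / (V / (V - m))) (div_pos hε hc)
    refine ⟨τ₀, hτ₀, fun τ hττ => ?_⟩
    obtain ⟨N₀, hN⟩ := hτ τ hττ
    refine ⟨N₀, fun N hNN s hs => ?_⟩
    calc ∫⁻ z, ENNReal.ofReal (((N : ℝ) + 1)⁻¹ * ∑ i : Fin (N + 1), tailFn V (f N τ s i z)) ∂(μ N)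
        ≤ ∫⁻ z, ENNReal.ofReal (V / (V - m)) *
            ENNReal.ofReal (((N : ℝ) + 1)⁻¹ * ∑ i : Fin (N + 1), max (f N τ s i z - m) 0) ∂(μ N) := by
          refine lintegral_mono fun z => ?_
          rw [← ENNReal.ofReal_mul hc.le]
          refine ENNReal.ofReal_le_ofReal ?_
          calc ((N : ℝ) + 1)⁻¹ * ∑ i : Fin (N + 1), tailFn V (f N τ s i z)
              ≤ ((N : ℝ) + 1)⁻¹ * ∑ i : Fin (N + 1), V / (V - m) * max (f N τ s i z - m) 0 :=
                mul_le_mul_of_nonneg_left (Finset.sum_le_sum fun i _ => tailFn_le_mul_posPart hm hmV _)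
                  (inv_nonneg.2 (by positivity))
            _ = V / (V - m) * (((N : ℝ) + 1)⁻¹ * ∑ i : Fin (N + 1), max (f N τ s i z - m) 0) := by
                rw [← Finset.mul_sum, mul_left_comm]
      _ = ENNReal.ofReal (V / (V - m)) *
            ∫⁻ z, ENNReal.ofReal (((N : ℝ) + 1)⁻¹ * ∑ i : Fin (N + 1), max (f N τ s i z - m) 0) ∂(μ N) :=
          lintegral_const_mul' _ _ ENNReal.ofReal_ne_top
      _ ≤ ENNReal.ofReal (V / (V - m)) * ENNReal.ofReal (ε / (V / (V - m))) := by gcongr; exact hN N hNN s hs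
      _ = ENNReal.ofReal ε := by
          rw [← ENNReal.ofReal_mul hc.le, mul_div_cancel₀ _ hc.ne']

/-! ## The crux, read as a one-sided LLN -/

/-- A hard-sphere flow of `N + 1` spheres of reduced diameter `σ` on `𝕋³` (the crux's `Φ N`). -/
abbrev Flow (σ : ℝ) (N : ℕ) : Type :=
  HardSphereFlow (Torus.geometry (Fin 3)) (hsDiameter σ N) (N + 1)

/-- Phase space of `N + 1` spheres on `𝕋³`. -/
abbrev Cfg (N : ℕ) : Type := Config (N + 1) (Fin 3) T3

/-- The crux's window `w_N = τ (N+1)^{-1/3}`. -/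
def window (τ : ℝ) (N : ℕ) : ℝ := τ * ((N : ℝ) + 1) ^ (-(1 / 3 : ℝ))

/-- The crux's window ACTIVITY of particle `i` over `(s, s + w]` along the orbit of `z` (verbatim the crux's `act`). -/
def act {σ : ℝ} {N : ℕ} (Φ : Flow σ N) (τ s : ℝ) (i : Fin (N + 1)) (z : Cfg N) : ℝ :=
  σ / τ * Φ.collisionSum (Set.Ioc s (s + window τ N))
    (fun c => if c.fst = i then ‖c.postVel.1 - c.preVel.1‖ else 0) z

/-- **COLLISION ACTIVITY EXCESS DECAY** — the level form of the crux. For continuous profiles there is `σ₀` such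
that for `0 < σ < σ₀`, every classical hs-Euler solution on `[0,T)` tied to the data by the `t = 0` LLN, every
flow family and every `t < T`, there is a LEVEL `m ≥ 0` with
`E_{λ_N}[(N+1)⁻¹ Σ_i (a_i(s) − m)₊] → 0` as `τ → ∞` after `N → ∞`, uniformly in `s ∈ [0,t]`:
the tagged window activity's `L¹`-limsup is essentially at most `m` (a one-sided law of large numbers in the
window length under the TRUE law). -/
def CollisionActivityExcessDecay : Prop :=
  ∀ (a₀ θ₀ : T3 → ℝ) (u₀ : T3 → V3), Continuous a₀ → Continuous θ₀ → Continuous u₀ →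
    (∀ x, 0 < a₀ x) → (∀ x, 0 < θ₀ x) → ∃ σ₀ : ℝ, 0 < σ₀ ∧ ∀ σ : ℝ, 0 < σ → σ < σ₀ →
    ∀ (T : ℝ) (ρ θ : ℝ → T3 → ℝ) (u : ℝ → T3 → V3), IsHardSphereEulerSolution σ T ρ u θ →
    ∀ Φ : (N : ℕ) → Flow σ N,
    TendstoHydroFieldsAt (fun N => localGibbsLaw σ a₀ u₀ θ₀ N (Φ N)) Φ ρ u θ 0 →
    ∀ t ∈ Set.Ico 0 T, ∃ m : ℝ, 0 ≤ m ∧ ∀ δ : ℝ, 0 < δ →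
    ∃ τ₀ : ℝ, 0 < τ₀ ∧ ∀ τ : ℝ, τ₀ ≤ τ → ∃ N₀ : ℕ, ∀ N : ℕ, N₀ ≤ N → ∀ s ∈ Set.Icc 0 t,
      ∫⁻ z, ENNReal.ofReal (((N : ℝ) + 1)⁻¹ * ∑ i : Fin (N + 1), max (act (Φ N) τ s i z - m) 0)
        ∂(localGibbsLaw σ a₀ u₀ θ₀ N (Φ N)) ≤ ENNReal.ofReal δ

/-- **The crux is exactly the level-form one-sided LLN for the tagged window activity** (crux decl
`…Theses.OneFlightGossipEngine.CollisionActivityTails`, stmt-AtomisticToContinuum-13734; registered helper stub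
`stub_collisionActivityTailsIffExcessDecay` of line `SketchK1`, now this theorem's deprecated alias):
`CollisionActivityTails ↔ CollisionActivityExcessDecay`, by `tailShape_iff_excessShape` under the common quantifier
prefix (the crux's `let`-bound integrand is `(N+1)⁻¹ Σ_i tailFn V (act (Φ N) τ s i z)` definitionally). -/
theorem collisionActivityTails_iff_excessDecay' :
    Summit.AtomisticToContinuum.HydrodynamicLimit.Theses.OneFlightGossipEngine.CollisionActivityTails ↔
      CollisionActivityExcessDecay := by
  constructor
  · intro h a₀ θ₀ u₀ ha hθ hu ha0 hθ0
    obtain ⟨σ₀, hσ₀, hσ⟩ := h a₀ θ₀ u₀ ha hθ hu ha0 hθ0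
    refine ⟨σ₀, hσ₀, fun σ hs hs' T ρ θ u hE Φ hL t ht => ?_⟩
    exact (tailShape_iff_excessShape (fun N => localGibbsLaw σ a₀ u₀ θ₀ N (Φ N))
      (fun N τ s i z => act (Φ N) τ s i z) (Set.Icc 0 t)).1 (hσ σ hs hs' T ρ θ u hE Φ hL t ht)
  · intro h a₀ θ₀ u₀ ha hθ hu ha0 hθ0
    obtain ⟨σ₀, hσ₀, hσ⟩ := h a₀ θ₀ u₀ ha hθ hu ha0 hθ0
    refine ⟨σ₀, hσ₀, fun σ hs hs' T ρ θ u hE Φ hL t ht => ?_⟩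
    exact (tailShape_iff_excessShape (fun N => localGibbsLaw σ a₀ u₀ θ₀ N (Φ N))
      (fun N τ s i z => act (Φ N) τ s i z) (Set.Icc 0 t)).2 (hσ σ hs hs' T ρ θ u hE Φ hL t ht)

/-- Former spelling of the same reading through the TwoClocks copy of the crux
(`…Theses.TwoClocks.CollisionActivityTails ↔ CollisionActivityExcessDecay`, landed p99623 and registered as stub
`stub_collisionActivityTailsIffExcessDecay` of stmt-13734): route TwoClocks rev 10 (2026-08-16) removed that copy
(restated as `TransferActivityTails`, stmt-16624), the statement of stmt-13734 being unchanged and still declared as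
`…Theses.OneFlightGossipEngine.CollisionActivityTails`; the name is kept (append-only) as an alias of
`collisionActivityTails_iff_excessDecay'`. -/
@[deprecated collisionActivityTails_iff_excessDecay' (since := "2026-08-17")]
alias stub_collisionActivityTailsIffExcessDecay := collisionActivityTails_iff_excessDecay'

end Summit.AtomisticToContinuum.HydrodynamicLimit.Theorems.CollisionActivityTailsExcessShape

end
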